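import Literature.AnabelianGeometry.AbsoluteAnabelian.MonoidKummerMapsTLGLiftReduction
import Mathlib.FieldTheory.PrimitiveElement
import HarnessLib

/-!
# [AbsTopIII] Prop 3.3 (ii): the typed `TLG` lifting sentence FORCES the continuity of abstract
# isomorphisms of absolute Galois groups of MLFs (why F-0412 needs a Nikolov–Segal-type input)

Proof-only companion (theorems only, no new definitions) of abc-iut-L4-t2's `MonoidKummerMaps.lean`
(S. Mochizuki, *Topics in Absolute Anabelian Geometry III*, Def. 3.1 (i)/(ii) pp. 66–67, Prop. 3.3 (ii)
p. 74; kurims manuscript, lit key `paper:url-5493eb38cbb7`).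

abc-iut-L6-d1 (`MonoidKummerMapsTLGLiftReduction.lean`) proved (BA_abs) ⇒ `UnitPairIsoFibres` (F-0412),
where (BA_abs) is the bi-anabelian statement for `k̄^×` with respect to ABSTRACT isomorphisms of the
Galois groups; `MonoidKummerMapsTLGLiftOfFiniteIndexOpen.lean` (this seat) proved (BA_abs) modulo the
Nikolov–Segal fact F-1977.  This file proves the CONVERSE bookkeeping, showing that the residual is not an
artefact of the reduction:

* `biAnabelianUnits_abstract_of_tlgLifting` — the typed `TLG` lifting sentence (all MLF-Galois
  `TLG`-pairs of Def. 3.1 (i)/(ii) AS TYPED: `ModelMLFGaloisData` allows ANY topological group `Π` with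
  a continuous surjection onto `Gal(k̄/k)`, in particular `Gal(k̄/k)` with the DISCRETE topology and
  `ε = id`) implies (BA_abs): apply the sentence to the discrete model pairs, between which every
  abstract `α` is an admissible isomorphism of topological groups;
* `unitPairIsoFibres_iff_biAnabelianUnits_abstract` — hence F-0412 `UnitPairIsoFibres` ⟺ (BA_abs)
  (with abc-iut-L6-t21's `unitPairIsoFibres_iff_exists_lift` and abc-iut-L6-d1's reduction);
* `continuous_galoisMulEquiv_of_equivariant` — an `α`-equivariant multiplicative bijection
  `β : k̄₁^× ⥲ k̄₂^×` forces `α` to be CONTINUOUS (it carries the open stabiliser `Gal(k̄₁/k₁(x))` into the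
  stabiliser of `β x`; every Krull neighbourhood of `1` contains a stabiliser, by the primitive element
  theorem);
* `continuous_galoisMulEquiv_of_unitPairIsoFibres` — so F-0412 implies that EVERY abstract isomorphism
  `Aut_{k₁}(k̄₁) ⥲ Aut_{k₂}(k̄₂)` between absolute Galois groups of MLFs is continuous — a statement of
  Nikolov–Segal type ([IUTchI] Rmk. 2.5.3 (vi); FACT-LIST F-1977 at `H = G_k`), which is why the tree
  discharges F-0412 only modulo F-1977 (`Summits/ABC/IUTFork/MonoidKummerMapsLiftsOfFiniteIndexOpen.lean`).

HONEST FRAMING: OUR kernel bookkeeping about the strength of a typed statement of a refereed paper; it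
neither proves nor refutes F-0412 or F-1977; nothing here bears on [IUTchIII] Cor. 3.12 or asserts
anything about abc.
-/

noncomputable section

open scoped nonZeroDivisors Topology

namespace Literature.AnabelianGeometry.AbsoluteAnabelian

/-! ### §1. Krull plumbing -/

/-- Pointwise stabilisers of the Krull action `Aut_k(K) ↷ K` (algebraic `K/k`) are open. [folklore] -/
private theorem isOpen_stabilizer_gal {k K : Type*} [Field k] [Field K] [Algebra k K]
    [Algebra.IsAlgebraic k K] (x : K) :
    IsOpen (MulAction.stabilizer (K ≃ₐ[k] K) x : Set (K ≃ₐ[k] K)) := by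
  haveI : FiniteDimensional k (IntermediateField.adjoin k {x}) :=
    IntermediateField.adjoin.finiteDimensional (Algebra.IsAlgebraic.isAlgebraic x).isIntegral
  have h : IsOpen ((IntermediateField.adjoin k {x}).fixingSubgroup : Set (K ≃ₐ[k] K)) :=
    IntermediateField.fixingSubgroup_isOpen (IntermediateField.adjoin k {x})
  refine Subgroup.isOpen_mono (H₁ := (IntermediateField.adjoin k {x}).fixingSubgroup) ?_ h
  intro τ hτ
  exact MulAction.mem_stabilizer_iff.mpr
    ((IntermediateField.mem_fixingSubgroup_iff _ _).mp hτ x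
      (IntermediateField.subset_adjoin k {x} (Set.mem_singleton x)))

/-- If `τ` fixes a primitive element `y` of a finite intermediate field `E = k⟮y⟯`, then `τ` fixes `E`
pointwise. [folklore] -/
private theorem mem_fixingSubgroup_of_apply_eq {k K : Type*} [Field k] [Field K] [Algebra k K]
    (E : IntermediateField k K) (y : K) (hE : E = IntermediateField.adjoin k {y})
    (τ : K ≃ₐ[k] K) (hτ : τ y = y) : τ ∈ E.fixingSubgroup := by
  have hle : MulAction.stabilizer (K ≃ₐ[k] K) y ≤ E.fixingSubgroup := by
    rw [← IntermediateField.le_iff_le, hE, IntermediateField.adjoin_simple_le_iff,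
      IntermediateField.mem_fixedField_iff]
    intro g hg
    exact MulAction.mem_stabilizer_iff.mp hg
  exact hle (MulAction.mem_stabilizer_iff.mpr hτ)

/-- **Discrete model data** (Def. 3.1 (i) AS TYPED admits it): `Π := Gal(k̄/k)` with the DISCRETE
topology (typed: every map out of `Π` is continuous) and `ε := id` is a legitimate `ModelMLFGaloisData`
(any topological group with a continuous surjection onto `Gal(k̄/k)`). [cite: MochizukiAbsTopIII2015, Definition 3.1 (i) p.66] -/
private theorem exists_discrete_modelMLFGaloisData (C : MLFClosure.{0}) :
    ∃ D : ModelMLFGaloisData C.k C.K, Function.Bijective D.aug ∧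
      ∀ (X : Type) [TopologicalSpace X] (g : D.Pi → X), Continuous g :=
  ⟨{ Pi := C.K ≃ₐ[C.k] C.K
     instTop := ⊥
     instTopGroup := by
       letI : TopologicalSpace (C.K ≃ₐ[C.k] C.K) := ⊥
       haveI : DiscreteTopology (C.K ≃ₐ[C.k] C.K) := ⟨rfl⟩
       infer_instance
     aug := MonoidHom.id _
     continuous_aug := continuous_bot
     aug_surjective := Function.surjective_id }, Function.bijective_id, fun _ _ _ => continuous_bot⟩

/-! ### §2. An equivariant `β` forces `α` to be continuous -/

/-- **An `α`-equivariant multiplicative bijection `β : k̄₁^× ⥲ k̄₂^×` forces the abstract group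
isomorphism `α : Aut_{k₁}(k̄₁) ⥲ Aut_{k₂}(k̄₂)` to be continuous** (Krull topologies): `α` maps the open
stabiliser of `β⁻¹ y` into the stabiliser of `y`, and every neighbourhood of `1` contains the
stabiliser of a primitive element of a finite subextension ([AbsTopIII] Rmk. 3.1.1: the topology of
`Gal(k̄/k)`-sets is determined by the algebraic structure). [cite: MochizukiAbsTopIII2015, Remark 3.1.1 p.70] -/
theorem continuous_galoisMulEquiv_of_equivariant (C₁ C₂ : MLFClosure.{0})
    (α : (C₁.K ≃ₐ[C₁.k] C₁.K) ≃* (C₂.K ≃ₐ[C₂.k] C₂.K)) (β : (C₁.K)⁰ ≃* (C₂.K)⁰)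
    (hβ : ∀ (σ : C₁.K ≃ₐ[C₁.k] C₁.K) (x y : (C₁.K)⁰), (y : C₁.K) = σ x →
      ((β y : (C₂.K)⁰) : C₂.K) = α σ ((β x : (C₂.K)⁰) : C₂.K)) :
    Continuous α := by
  refine continuous_of_continuousAt_one α.toMonoidHom ?_
  rw [ContinuousAt, map_one]
  refine Filter.tendsto_def.mpr fun s hs => ?_
  obtain ⟨E, hEfin, hEs⟩ := (krullTopology_mem_nhds_one_iff C₂.k C₂.K s).mp hs
  haveI := hEfin
  obtain ⟨y, hy⟩ := Field.exists_primitive_element C₂.k E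
  have hE : E = IntermediateField.adjoin C₂.k {(y : C₂.K)} := by
    rw [← IntermediateField.lift_adjoin_simple, hy, IntermediateField.lift_top]
  by_cases hy0 : (y : C₂.K) = 0
  · -- every automorphism fixes `y = 0`, so `E.fixingSubgroup = ⊤` and `α ⁻¹' s = univ`
    refine Filter.univ_mem' fun σ => ?_
    show α.toMonoidHom σ ∈ s
    refine hEs (mem_fixingSubgroup_of_apply_eq E (y : C₂.K) hE _ ?_)
    rw [hy0, map_zero]
  · -- `y ≠ 0`: pull back along `β`
    set y' : (C₂.K)⁰ := ⟨(y : C₂.K), mem_nonZeroDivisors_of_ne_zero hy0⟩ with hy'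
    set x : (C₁.K)⁰ := β.symm y' with hx
    have hβx : ((β x : (C₂.K)⁰) : C₂.K) = (y : C₂.K) := by
      rw [hx, MulEquiv.apply_symm_apply]
    refine Filter.mem_of_superset ((isOpen_stabilizer_gal (k := C₁.k) (x : C₁.K)).mem_nhds
      (Subgroup.one_mem _)) fun σ hσ => ?_
    have hσx : σ (x : C₁.K) = (x : C₁.K) := MulAction.mem_stabilizer_iff.mp hσ
    show α.toMonoidHom σ ∈ s
    refine hEs (mem_fixingSubgroup_of_apply_eq E (y : C₂.K) hE _ ?_)
    have key := hβ σ x x hσx.symm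
    -- key : ↑(β x) = (α σ) ↑(β x)
    rw [hβx] at key
    exact key.symm

/-! ### §3. The typed `TLG` lifting sentence implies (BA_abs) -/

/-- **The typed `TLG` lifting sentence implies (BA_abs)**: if every admissible isomorphism of topological
groups between MLF-Galois `TLG`-pairs lifts to an isomorphism of pairs, then every ABSTRACT isomorphism
`α : Aut_{k₁}(k̄₁) ⥲ Aut_{k₂}(k̄₂)` admits an `α`-equivariant multiplicative bijection `k̄₁^× ⥲ k̄₂^×` —
apply the sentence to the model pairs with `Π := Gal(k̄/k)` DISCRETE and `ε := id` (legitimate model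
data of Def. 3.1 (i) as typed), between which `α` is a homeomorphism with trivial arithmetic kernels.
[cite: MochizukiAbsTopIII2015, Definition 3.1 (i) p.66] [cite: MochizukiAbsTopIII2015, Proposition 3.3 (ii) p.74] -/
theorem biAnabelianUnits_abstract_of_tlgLifting
    (hL : ∀ (P Q : GaloisMonoidPair.{0}), IsMLFGaloisMonoidPair .TLG P → IsMLFGaloisMonoidPair .TLG Q →
      ∀ f : P.Pi ≃ₜ* Q.Pi, P.actionKer.map f.toMulEquiv.toMonoidHom = Q.actionKer →
        ∃ e : GaloisMonoidPair.Iso P Q, e.isoPi = f)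
    (C₁ C₂ : MLFClosure.{0}) (α : (C₁.K ≃ₐ[C₁.k] C₁.K) ≃* (C₂.K ≃ₐ[C₂.k] C₂.K)) :
    ∃ β : (C₁.K)⁰ ≃* (C₂.K)⁰, ∀ (σ : C₁.K ≃ₐ[C₁.k] C₁.K) (x y : (C₁.K)⁰), (y : C₁.K) = σ x →
      ((β y : (C₂.K)⁰) : C₂.K) = α σ ((β x : (C₂.K)⁰) : C₂.K) := by
  -- the discrete model data `(Gal(k̄ᵢ/kᵢ)^{disc} —≅→ Gal(k̄ᵢ/kᵢ))`
  obtain ⟨D₁, hb₁, hd₁⟩ := exists_discrete_modelMLFGaloisData C₁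
  obtain ⟨D₂, hb₂, hd₂⟩ := exists_discrete_modelMLFGaloisData C₂
  let a₁ : D₁.Pi ≃* (C₁.K ≃ₐ[C₁.k] C₁.K) := MulEquiv.ofBijective D₁.aug hb₁
  let a₂ : D₂.Pi ≃* (C₂.K ≃ₐ[C₂.k] C₂.K) := MulEquiv.ofBijective D₂.aug hb₂
  have ha₁ : ∀ g, a₁ g = D₁.aug g := fun _ => rfl
  have ha₂ : ∀ g, a₂ g = D₂.aug g := fun _ => rfl
  -- `α` as an isomorphism of the discrete topological groups
  let f : D₁.tlgPair.Pi ≃ₜ* D₂.tlgPair.Pi :=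
    { a₁.trans (α.trans a₂.symm) with
      continuous_toFun := hd₁ _ _
      continuous_invFun := hd₂ _ _ }
  have hfα : ∀ g : D₁.Pi, D₂.aug (f g) = α (D₁.aug g) := fun g => by
    show D₂.aug (a₂.symm (α (a₁ g))) = α (D₁.aug g)
    rw [← ha₂, MulEquiv.apply_symm_apply, ha₁]
  have hf : D₁.tlgPair.actionKer.map f.toMulEquiv.toMonoidHom = D₂.tlgPair.actionKer := by
    rw [ModelMLFGaloisData.tlgPair_actionKer C₁ D₁, ModelMLFGaloisData.tlgPair_actionKer C₂ D₂,
      (MonoidHom.ker_eq_bot_iff D₁.aug).mpr hb₁.1, (MonoidHom.ker_eq_bot_iff D₂.aug).mpr hb₂.1,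
      Subgroup.map_bot]
  obtain ⟨e, he⟩ := hL D₁.tlgPair D₂.tlgPair (isMLFGaloisMonoidPair_tlgPair C₁ D₁)
    (isMLFGaloisMonoidPair_tlgPair C₂ D₂) f hf
  refine ⟨e.isoM, fun σ x y hxy => ?_⟩
  -- `y = g • x` in the model pair, for `g` over `σ`
  have hg : D₁.aug (a₁.symm σ) = σ := by rw [← ha₁, MulEquiv.apply_symm_apply]
  have hxy' : y = (a₁.symm σ : D₁.tlgPair.Pi) • x := Subtype.ext (by
    show (y : C₁.K) = D₁.aug (a₁.symm σ) • (x : C₁.K)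
    rw [hg, hxy]
    rfl)
  have h1 := e.smul_comm (a₁.symm σ : D₁.tlgPair.Pi) x
  -- h1 : e.isoM (g • x) = e.isoPi g • e.isoM x
  rw [← hxy', he] at h1
  have h2 := congrArg (fun z : D₂.tlgPair.M => ((z : (C₂.K)⁰) : C₂.K)) h1
  -- the model action on the right: `(f g • m : k̄₂^×) = ε₂ (f g) • m = (α σ) m`
  have h3 : (((f (a₁.symm σ) : D₂.tlgPair.Pi) • e.isoM x : D₂.tlgPair.M) : C₂.K) =
      α σ ((e.isoM x : (C₂.K)⁰) : C₂.K) := by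
    show D₂.aug (f (a₁.symm σ)) • ((e.isoM x : (C₂.K)⁰) : C₂.K) = _
    rw [hfα, hg]
    rfl
  exact h2.trans h3

/-- **F-0412 `UnitPairIsoFibres` ⟺ (BA_abs)** — the pre-erratum named fact of [AbsTopIII] Prop. 3.3 (ii),
as typed, is EQUIVALENT to the bi-anabelian statement for `k̄^×` with respect to abstract isomorphisms
of the Galois groups (⇐ abc-iut-L6-d1 `unitPairIsoFibres_of_biAnabelianUnits_abstract`; ⇒ abc-iut-L6-t21
`unitPairIsoFibres_iff_exists_lift` and the discrete model pairs).
[cite: MochizukiAbsTopIII2015, Proposition 3.3 (ii) p.74] -/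
theorem unitPairIsoFibres_iff_biAnabelianUnits_abstract :
    UnitPairIsoFibres ↔
      ∀ (C₁ C₂ : MLFClosure.{0}) (α : (C₁.K ≃ₐ[C₁.k] C₁.K) ≃* (C₂.K ≃ₐ[C₂.k] C₂.K)),
        ∃ β : (C₁.K)⁰ ≃* (C₂.K)⁰, ∀ (σ : C₁.K ≃ₐ[C₁.k] C₁.K) (x y : (C₁.K)⁰), (y : C₁.K) = σ x →
          ((β y : (C₂.K)⁰) : C₂.K) = α σ ((β x : (C₂.K)⁰) : C₂.K) :=
  ⟨fun h => biAnabelianUnits_abstract_of_tlgLifting (unitPairIsoFibres_iff_exists_lift.mp h),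
    fun h => unitPairIsoFibres_of_biAnabelianUnits_abstract h⟩

/-- **F-0412 forces the continuity of abstract isomorphisms of absolute Galois groups of MLFs**: if
`UnitPairIsoFibres` holds (as typed, over all MLF-Galois pairs of Def. 3.1 (i)/(ii)), then every
isomorphism of GROUPS `Aut_{k₁}(k̄₁) ⥲ Aut_{k₂}(k̄₂)` (`kᵢ` `p`-adic local fields, `k̄ᵢ` algebraic closures)
is continuous for the Krull topologies — the instance at `H = G_k` of the Nikolov–Segal-type statement
quoted in [IUTchI] Rmk. 2.5.3 (vi) (FACT-LIST F-1977), which is therefore a NECESSARY input of any proof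
of F-0412 from local class field theory. [cite: MochizukiAbsTopIII2015, Proposition 3.3 (ii) p.74]
[cite: Mochizuki2012, IUTchI Rmk 2.5.3 (vi) (O3) p.56] -/
theorem continuous_galoisMulEquiv_of_unitPairIsoFibres (h : UnitPairIsoFibres) (C₁ C₂ : MLFClosure.{0})
    (α : (C₁.K ≃ₐ[C₁.k] C₁.K) ≃* (C₂.K ≃ₐ[C₂.k] C₂.K)) : Continuous α := by
  obtain ⟨β, hβ⟩ := unitPairIsoFibres_iff_biAnabelianUnits_abstract.mp h C₁ C₂ α
  exact continuous_galoisMulEquiv_of_equivariant C₁ C₂ α β hβ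

/-- Packaged form: under F-0412 every abstract isomorphism of the Galois groups of two MLF closure data IS
(the map of) an isomorphism of topological groups. [cite: MochizukiAbsTopIII2015, Proposition 3.3 (ii) p.74] -/
theorem exists_galoisContinuousMulEquiv_of_unitPairIsoFibres (h : UnitPairIsoFibres)
    (C₁ C₂ : MLFClosure.{0}) (α : (C₁.K ≃ₐ[C₁.k] C₁.K) ≃* (C₂.K ≃ₐ[C₂.k] C₂.K)) :
    ∃ α' : (C₁.K ≃ₐ[C₁.k] C₁.K) ≃ₜ* (C₂.K ≃ₐ[C₂.k] C₂.K), ∀ σ, α' σ = α σ :=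
  ⟨{ α with
      continuous_toFun := continuous_galoisMulEquiv_of_unitPairIsoFibres h C₁ C₂ α
      continuous_invFun := continuous_galoisMulEquiv_of_unitPairIsoFibres h C₂ C₁ α.symm },
    fun _ => rfl⟩

end Literature.AnabelianGeometry.AbsoluteAnabelian

end
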